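import Summits.QuantumFields.BalabanUV.T4Continuum.Spine.BackgroundResolventTower

/-!
# T⁴ programme, spine node NE2 (U1a) — KRONECKER LIFT `X ↦ X ⊗ 1` of the free tower to colour components (tier B, row B1.a of
# `t4/SKELETON-NE2-P1.md`)

Ninth generation of the NE2 prover lineage P1 of the cell `pub-balaban`, file 16.  Bałaban's vector fields are `𝔤`-valued: the free
operator on `𝔤`-valued 1-forms is `Δ_a ⊗ 1_m` (componentwise), while a background couples the colour components.  This file proves,
for ARBITRARY finite index types, that the Kronecker lift `X ↦ X ⊗ₖ (1 : Matrix o o ℂ)` (i) is an algebra map commuting with `ᴴ` and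
`⁻¹` (Mathlib), (ii) does not increase the `ℓ²` operator norm (**`opNorm_kron_le`**, rectangular, via `‖X‖² = ‖XᴴX‖` and the tree's
`opNorm_blockDiagonal_le`), and hence (iii) transports the typed tower hypotheses: **`freeTowerLaws_kron`**
(`FreeTowerLaws D A J F r e₀ e₁ f → FreeTowerLaws (D ⊗ 1) (A ⊗ 1) (J ⊗ 1) (F ⊗ 1) r e₀ e₁ f`) and **`perturbationLaws_kron`**.  So every
`U = 1` input of the resolvent route (King's pairing, (1.69)/(1.83)/(1.89) bounds) is available on `(torus sites × components) × colours`
BY NAME, and tier B only has to produce `PerturbationLaws` for colour-mixing perturbations.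

HONEST FRAMING (T4-DAG p. 1).  Pure finite-dimensional linear algebra; no estimate of the programme is touched; rates / constants OURS;
NOT infinite volume / mass gap / Clay / summit progress; spine 0/9 unchanged.  HONEST DEPENDENCY: continuum YM on T⁴ ⇐ BetaPertH ∧ nine
spine estimates (0/9 proved); BetaPertH ⇐ (D1) ∧ (D4) ∧ CAP+tail; G-an2-4 gates asym, D1 and NE2/3/4.  ABSOLUTE RULE kept; no `sorry`.
-/

noncomputable section

open scoped BigOperators ComplexConjugate Matrix Matrix.Norms.L2Operator Kronecker

namespace Summit.QuantumFields.BalabanUV.T4Continuum.KroneckerLift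

open Literature.MathematicalPhysics.QuantumFieldTheory.Balaban1983to89.B5Prop11Plancherel (opNorm_blockDiagonal_le)
open Summit.QuantumFields.BalabanUV.T4Continuum.BackgroundResolventTower

/-! ## §1 The lift on one pair of index types -/

section One

variable {l m n : Type*} [Fintype l] [Fintype m] [Fintype n] [DecidableEq l] [DecidableEq m] [DecidableEq n]
variable (o : Type*) [Fintype o] [DecidableEq o]

omit [Fintype l] [Fintype m] [Fintype n] [DecidableEq l] [DecidableEq m] [DecidableEq n] in
/-- subtraction passes through the left Kronecker factor. [folklore] -/
theorem sub_kronecker (A B : Matrix l m ℂ) (C : Matrix n n ℂ) : (A - B) ⊗ₖ C = A ⊗ₖ C - B ⊗ₖ C := by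
  rw [eq_sub_iff_add_eq, ← Matrix.add_kronecker, sub_add_cancel]

omit [DecidableEq l] in
/-- **the lift does not increase the operator norm** (rectangular): `‖X ⊗ 1‖ ≤ ‖X‖`. [folklore] -/
theorem opNorm_kron_le (A : Matrix l m ℂ) : ‖A ⊗ₖ (1 : Matrix o o ℂ)‖ ≤ ‖A‖ := by
  have hsq : ∀ B : Matrix m m ℂ, ‖B ⊗ₖ (1 : Matrix o o ℂ)‖ ≤ ‖B‖ := fun B => by
    rw [Matrix.kronecker_one]; exact opNorm_blockDiagonal_le _ (norm_nonneg B) fun _ => le_rfl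
  have h1 : ‖A ⊗ₖ (1 : Matrix o o ℂ)‖ * ‖A ⊗ₖ (1 : Matrix o o ℂ)‖ = ‖(Aᴴ * A) ⊗ₖ (1 : Matrix o o ℂ)‖ := by
    rw [← Matrix.l2_opNorm_conjTranspose_mul_self, Matrix.conjTranspose_kronecker, Matrix.conjTranspose_one,
      ← Matrix.mul_kronecker_mul, Matrix.one_mul]
  have h2 : ‖(Aᴴ * A) ⊗ₖ (1 : Matrix o o ℂ)‖ ≤ ‖A‖ * ‖A‖ :=
    (hsq _).trans (le_of_eq (Matrix.l2_opNorm_conjTranspose_mul_self A))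
  exact (mul_self_le_mul_self_iff (norm_nonneg _) (norm_nonneg _)).mpr (h1 ▸ h2)

omit [Fintype l] [Fintype n] [DecidableEq l] [DecidableEq m] [DecidableEq n] in
/-- products lift. [folklore] -/
theorem kron_mul (A : Matrix l m ℂ) (B : Matrix m n ℂ) :
    (A * B) ⊗ₖ (1 : Matrix o o ℂ) = A ⊗ₖ (1 : Matrix o o ℂ) * B ⊗ₖ (1 : Matrix o o ℂ) := by
  rw [← Matrix.mul_kronecker_mul, Matrix.one_mul]

/-- inverses lift. [folklore] -/
theorem kron_inv (A : Matrix m m ℂ) : (A ⊗ₖ (1 : Matrix o o ℂ))⁻¹ = A⁻¹ ⊗ₖ (1 : Matrix o o ℂ) := by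
  rw [Matrix.inv_kronecker, inv_one]

omit [Fintype l] [Fintype m] [DecidableEq l] [DecidableEq m] [Fintype o] in
/-- adjoints lift. [folklore] -/
theorem kron_conjTranspose (A : Matrix l m ℂ) : (A ⊗ₖ (1 : Matrix o o ℂ))ᴴ = Aᴴ ⊗ₖ (1 : Matrix o o ℂ) := by
  rw [Matrix.conjTranspose_kronecker, Matrix.conjTranspose_one]

/-- invertibility lifts. [folklore] -/
theorem isUnit_det_kron {A : Matrix m m ℂ} (h : IsUnit A.det) : IsUnit (A ⊗ₖ (1 : Matrix o o ℂ)).det := by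
  rw [Matrix.det_kronecker, Matrix.det_one, one_pow, mul_one]; exact h.pow _

omit [DecidableEq l] in
/-- a normed identity lifts: `‖X ⊗ 1‖ ≤ b` from `‖X‖ ≤ b`. [folklore] -/
theorem opNorm_kron_le_of_le {A : Matrix l m ℂ} {b : ℝ} (h : ‖A‖ ≤ b) : ‖A ⊗ₖ (1 : Matrix o o ℂ)‖ ≤ b :=
  (opNorm_kron_le o A).trans h

end One

/-! ## §2 Transport of the typed tower hypotheses -/

section Tower

variable {ι : ℕ → Type*} [∀ k, Fintype (ι k)] [∀ k, DecidableEq (ι k)] (o : Type*) [Fintype o] [DecidableEq o]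

/-- **`FreeTowerLaws` LIFT TO COLOUR COMPONENTS.** [folklore] -/
theorem freeTowerLaws_kron {D : (k : ℕ) → Matrix (ι k) (ι k) ℂ} {A : (k : ℕ) → Matrix (ι k) (ι (k + 1)) ℂ}
    {J : (k : ℕ) → Matrix (ι (k + 1)) (ι k) ℂ} {F : (k : ℕ) → Matrix (ι k) (ι k) ℂ} {r : ℝ} {e₀ e₁ f : ℕ → ℝ}
    (h : FreeTowerLaws D A J F r e₀ e₁ f) :
    FreeTowerLaws (fun k => D k ⊗ₖ (1 : Matrix o o ℂ)) (fun k => A k ⊗ₖ (1 : Matrix o o ℂ)) (fun k => J k ⊗ₖ (1 : Matrix o o ℂ))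
      (fun k => F k ⊗ₖ (1 : Matrix o o ℂ)) r e₀ e₁ f where
  isUnit_det := fun k => isUnit_det_kron o (h.isUnit_det k)
  opNorm_A_sq_le := fun k => (pow_le_pow_left₀ (norm_nonneg _) (opNorm_kron_le o (A k)) 2).trans (h.opNorm_A_sq_le k)
  opNorm_J_le := fun k => opNorm_kron_le_of_le o (h.opNorm_J_le k)
  A_mul_J := fun k => by
    rw [← kron_mul, ← Matrix.smul_kronecker, h.A_mul_J k, Matrix.add_kronecker, Matrix.one_kronecker_one]
  opNorm_F_mul_inv_le := fun k => by
    rw [kron_inv, ← kron_mul]; exact opNorm_kron_le_of_le o (h.opNorm_F_mul_inv_le k)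
  opNorm_inv_mul_F_le := fun k => by
    rw [kron_inv, kron_conjTranspose, ← kron_mul]; exact opNorm_kron_le_of_le o (h.opNorm_inv_mul_F_le k)
  complement_le := fun k => by
    rw [kron_inv, kron_conjTranspose, ← kron_mul, ← Matrix.one_kronecker_one (m := ι (k + 1)) (n := o), ← sub_kronecker,
      ← kron_mul]
    exact opNorm_kron_le_of_le o (h.complement_le k)
  injected_le := fun k => by
    rw [kron_inv, kron_inv, ← kron_mul, ← kron_mul, ← sub_kronecker]; exact opNorm_kron_le_of_le o (h.injected_le k)

/-- `PerturbationLaws` LIFT for colour-diagonal perturbations `P ⊗ 1`. [folklore] -/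
theorem perturbationLaws_kron {D P : (k : ℕ) → Matrix (ι k) (ι k) ℂ} {J : (k : ℕ) → Matrix (ι (k + 1)) (ι k) ℂ} {κ : ℝ}
    {e₂ : ℕ → ℝ} (h : PerturbationLaws D P J κ e₂) :
    PerturbationLaws (fun k => D k ⊗ₖ (1 : Matrix o o ℂ)) (fun k => P k ⊗ₖ (1 : Matrix o o ℂ)) (fun k => J k ⊗ₖ (1 : Matrix o o ℂ))
      κ e₂ where
  opNorm_P_mul_inv_le := fun k => by rw [kron_inv, ← kron_mul]; exact opNorm_kron_le_of_le o (h.opNorm_P_mul_inv_le k)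
  opNorm_inv_mul_P_le := fun k => by rw [kron_inv, ← kron_mul]; exact opNorm_kron_le_of_le o (h.opNorm_inv_mul_P_le k)
  consistent_le := fun k => by
    rw [kron_inv, kron_inv, ← kron_mul, ← kron_mul, ← sub_kronecker, ← kron_mul, ← kron_mul]
    exact opNorm_kron_le_of_le o (h.consistent_le k)

end Tower

end Summit.QuantumFields.BalabanUV.T4Continuum.KroneckerLift

end
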